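import Literature.Topology.FourManifolds.GroupTrisections
import Summits.SmoothPoincare4.SmoothPoincare4.Theorems.CongruenceShadowsShadowsStandardStubGoeritzS1
import Summits.SmoothPoincare4.SmoothPoincare4.Theorems.CongruenceShadowsShadowsStandardStubGoeritzS2
import HarnessLib
import Mathlib.Algebra.Group.Int.Units
import Mathlib.Algebra.Group.Subgroup.Lattice
import Mathlib.Algebra.Group.Subgroup.Map
import Mathlib.Algebra.Group.Subgroup.Ker
import Mathlib.Algebra.Group.TypeTags.Basic

/-!
# Stub `stub_faceEuclid` of line `power-twist-absorption` for crux `CongruenceShadows.ShadowsStandard`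
(item stmt-SmoothPoincare4-14593, route route-SmoothPoincare4-CongruenceShadows; `--supports` the crux)

**The Euclidean algorithm on the face of the standard genus-3 Heegaard pair.**  Let
`S₃ = ⟨a₁,b₁,a₂,b₂,a₃,b₃ ∣ [a₁,b₁][a₂,b₂][a₃,b₃]⟩` (`SurfaceGroup 3`; `aᵢ₊₁ = SurfaceGroup.a i`,
`bᵢ₊₁ = SurfaceGroup.b i`), `N₀ = ⟪a₁,a₂,b₃⟫ = s4Kernels 0`, `N₁ = ⟪a₁,b₂,a₃⟫ = s4Kernels 1`.
A character `f : S₃ →* ℤ` (written multiplicatively, `Multiplicative ℤ`) killing `a₁, a₂, b₃` kills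
`N₀`, so it is recorded by its values `v = (v₁,v₂,v₃) = (f b₁, f b₂, f a₃)`; the hypotheses
"`f` surjective and `N₁ ⊔ ker f = ⊤`" say `f(N₁) = ⟨v₂, v₃⟩ = ℤ`, i.e. `gcd(v₂,v₃) = 1`
(`coprime`).  The three Goeritz elements of the pair `(N₀,N₁)` (automorphisms of `S₃` stabilising
both kernels) act on the values of `f ∘ χ` by `σ₂₃ : v ↦ (v₁,v₃,v₂)` (re-derived here from its
generator images, cf. the landed `stub_goeritzSigma23`), `S₂^{∓1} : v ↦ (v₁,v₂,v₃ ± v₂)`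
(`stub_goeritzS2`), `S₁^{∓1} : v ↦ (v₁ ± v₂,v₂,v₃)` (`stub_goeritzS1`, for `f a₁ = 0`) — only values
matter since the target is abelian (`moveSigma`, `moveS2`, `moveS1`).  Precomposition with such a
`χ₀` preserves the hypotheses (`hyp_comp`: `χ₀(N₀) = N₀ ≤ ker f`, and `N₁ ⊔ ker (f ∘ χ₀) =
χ₀⁻¹(N₁ ⊔ ker f) = ⊤`), and a normalising automorphism `χ` for `f ∘ χ₀` yields the normalising
automorphism `χ₀ ∘ χ` for `f` (`concl_comp`).  Hence the Euclidean algorithm runs: by strong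
induction on `|v₂| + |v₃|`, swap so that `|v₂| ≤ |v₃|`, and if both are non-zero replace `v₃` by
`v₃ ± v₂` of strictly smaller modulus; if `v₂ = 0` then `v₃ = ±1` and one swap gives `v₃ = 0`; if
`v₃ = 0` then `v₂ = ±1` and `|v₁|` applications of `S₁^{±1}` (`terminal`) reach `v = (0, ±1, 0)`,
i.e. `f ∘ χ` is `±` the standard face character: `b₂ ↦ ±1`, every other generator `↦ 0`.

This is the registered stub `stub_faceEuclid` (STUB F2) of the checked skeleton of the line.
Pure group theory over the tree's `SurfaceGroup` and the landed Goeritz theorems `stub_goeritzS1`,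
`stub_goeritzS2`; no definitions, no named facts.
-/

-- the prescribed namespace `Summit.<P>.<Sub>.…` duplicates `SmoothPoincare4` (P = Sub)
set_option linter.dupNamespace false

open Literature.Topology.FourManifolds Subgroup Multiplicative

namespace Summit.SmoothPoincare4.SmoothPoincare4.Theorems.ShadowsStandard.PowerTwistAbsorption

/-! ### Moves: the Goeritz elements act on the values `(f b₁, f b₂, f a₃)` of a character -/

/-- The Goeritz involution `σ₂₃ : a₁ ↦ a₁⁻¹, b₁ ↦ a₁b₁a₁⁻¹, a₂ ↦ b₃, b₂ ↦ a₃, a₃ ↦ b₂, b₃ ↦ a₂`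
(it sends the relator `r` to `[b₁,a₁] r⁻¹ [b₁,a₁]⁻¹` and is a free involution on the generators,
both identities decided in the free group) stabilises `N₀`, `N₁` and swaps the values of any
character `f : S₃ → ℤ` on `b₂` and `a₃`.  Self-contained copy of the landed `stub_goeritzSigma23`
(`Theorems/CongruenceShadowsShadowsStandardStubGoeritzSigma23.lean`). [folklore] -/
private theorem moveSigma :
    ∃ χ : SurfaceGroup 3 ≃* SurfaceGroup 3,
      ((s4Kernels 0).map χ.toMonoidHom = s4Kernels 0 ∧ (s4Kernels 1).map χ.toMonoidHom = s4Kernels 1) ∧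
      ∀ f : SurfaceGroup 3 →* Multiplicative ℤ,
        toAdd (f (χ (SurfaceGroup.b 1))) = toAdd (f (SurfaceGroup.a 2)) ∧
        toAdd (f (χ (SurfaceGroup.a 2))) = toAdd (f (SurfaceGroup.b 1)) := by
  -- adapted from `exists_involution_of_gens` / `stub_goeritzSigma23` (landed module above)
  let F : surfaceGen 3 → FreeGroup (surfaceGen 3) := fun x =>
    if x.1 = 0 then (if x.2 = false then (FreeGroup.of x)⁻¹ else genA 0 * FreeGroup.of x * (genA 0)⁻¹)
    else if x.1 = 1 then (if x.2 = false then genB 2 else genA 2)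
    else (if x.2 = false then genB 1 else genA 1)
  have hr : FreeGroup.lift F (surfaceRelator 3) = (genB 0 * genA 0 * (genB 0)⁻¹ * (genA 0)⁻¹) *
      (surfaceRelator 3)⁻¹ * (genB 0 * genA 0 * (genB 0)⁻¹ * (genA 0)⁻¹)⁻¹ := by decide
  have hinv : ∀ x, FreeGroup.lift F (F x) = FreeGroup.of x := by decide
  let φ : SurfaceGroup 3 →* SurfaceGroup 3 :=
    presentedLift ((PresentedGroup.mk _).comp (FreeGroup.lift F)) (by
      intro r hr'
      rw [Set.mem_singleton_iff] at hr'
      subst hr'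
      rw [MonoidHom.comp_apply, hr, map_mul, map_mul, map_inv, map_inv,
        PresentedGroup.one_of_mem (Set.mem_singleton _), inv_one, mul_one, mul_inv_cancel])
  have hφ : ∀ w, φ (PresentedGroup.mk _ w) = PresentedGroup.mk _ (FreeGroup.lift F w) :=
    fun w => presentedLift_mk _ _ w
  have hφφ : φ.comp φ = MonoidHom.id _ :=
    PresentedGroup.ext fun x => by
      simp only [MonoidHom.comp_apply, MonoidHom.id_apply, PresentedGroup.of, hφ,
        FreeGroup.lift_apply_of, hinv]
  have ha0 : φ (SurfaceGroup.a 0) = (SurfaceGroup.a 0)⁻¹ := by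
    simp [SurfaceGroup.a, PresentedGroup.of, hφ, F]
  have ha1 : φ (SurfaceGroup.a 1) = SurfaceGroup.b 2 := by
    simp [SurfaceGroup.a, SurfaceGroup.b, PresentedGroup.of, hφ, F, genB]
  have hb1 : φ (SurfaceGroup.b 1) = SurfaceGroup.a 2 := by
    simp [SurfaceGroup.a, SurfaceGroup.b, PresentedGroup.of, hφ, F, genA]
  have ha2 : φ (SurfaceGroup.a 2) = SurfaceGroup.b 1 := by
    simp [SurfaceGroup.a, SurfaceGroup.b, PresentedGroup.of, hφ, F, genB]
  have hb2 : φ (SurfaceGroup.b 2) = SurfaceGroup.a 1 := by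
    simp [SurfaceGroup.a, SurfaceGroup.b, PresentedGroup.of, hφ, F, genA]
  -- an involution maps `⟪s⟫` onto itself as soon as it maps `s` into `⟪s⟫`
  have stab : ∀ s : Set (SurfaceGroup 3), (∀ x ∈ s, φ x ∈ normalClosure s) →
      (normalClosure s).map (MonoidHom.toMulEquiv φ φ hφφ hφφ).toMonoidHom = normalClosure s := by
    intro s h
    apply le_antisymm
    · rw [Subgroup.map_le_iff_le_comap]
      exact Subgroup.normalClosure_le_normal fun x hx => by simpa using h x hx
    · rw [Subgroup.map_equiv_eq_comap_symm']
      exact Subgroup.normalClosure_le_normal fun x hx => by simpa using h x hx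
  refine ⟨MonoidHom.toMulEquiv φ φ hφφ hφφ, ⟨stab _ ?_, stab _ ?_⟩, fun f => ⟨?_, ?_⟩⟩
  · rintro x (rfl | rfl | rfl)
    · exact ha0 ▸ inv_mem (subset_normalClosure (Set.mem_insert _ _))
    · exact ha1 ▸ subset_normalClosure (Set.mem_insert_of_mem _ (Set.mem_insert_of_mem _ rfl))
    · exact hb2 ▸ subset_normalClosure (Set.mem_insert_of_mem _ (Set.mem_insert _ _))
  · rintro x (rfl | rfl | rfl)
    · exact ha0 ▸ inv_mem (subset_normalClosure (Set.mem_insert _ _))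
    · exact hb1 ▸ subset_normalClosure (Set.mem_insert_of_mem _ (Set.mem_insert_of_mem _ rfl))
    · exact ha2 ▸ subset_normalClosure (Set.mem_insert_of_mem _ (Set.mem_insert _ _))
  · exact congrArg (fun x => toAdd (f x)) hb1
  · exact congrArg (fun x => toAdd (f x)) ha2

/-- The Goeritz elements `S₂^{∓1}` change the values `(v₂, v₃)` of any character `f : S₃ → ℤ` on
`(b₂, a₃)` to `(v₂, v₃ ± v₂)`. [folklore] -/
private theorem moveS2 (u : ℤ) (hu : u = 1 ∨ u = -1) :
    ∃ χ : SurfaceGroup 3 ≃* SurfaceGroup 3,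
      ((s4Kernels 0).map χ.toMonoidHom = s4Kernels 0 ∧ (s4Kernels 1).map χ.toMonoidHom = s4Kernels 1) ∧
      ∀ f : SurfaceGroup 3 →* Multiplicative ℤ,
        toAdd (f (χ (SurfaceGroup.b 1))) = toAdd (f (SurfaceGroup.b 1)) ∧
        toAdd (f (χ (SurfaceGroup.a 2))) =
          toAdd (f (SurfaceGroup.a 2)) + u * toAdd (f (SurfaceGroup.b 1)) := by
  obtain ⟨χ, -, -, -, h4, h5, h6, hN0, hN1⟩ := stub_goeritzS2
  rcases hu with rfl | rfl
  · -- `u = 1`: the inverse `S₂⁻¹`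
    have k4 : χ.symm (SurfaceGroup.b 1) = SurfaceGroup.b 1 := by
      simpa using (congrArg χ.symm h4).symm
    have k6 : χ.symm (SurfaceGroup.b 2) = SurfaceGroup.b 2 := by
      simpa using (congrArg χ.symm h6).symm
    have k5 := congrArg χ.symm h5
    simp only [MulEquiv.symm_apply_apply, map_mul, map_inv, k4, k6] at k5
    refine ⟨χ.symm,
      ⟨(Subgroup.map_symm_eq_iff_map_eq _).2 hN0, (Subgroup.map_symm_eq_iff_map_eq _).2 hN1⟩,
      fun f => ⟨by rw [k4], ?_⟩⟩
    have e := congrArg (fun x => toAdd (f x)) k5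
    simp only [map_mul, map_inv, toAdd_mul, toAdd_inv] at e
    omega
  · -- `u = -1`: `S₂` itself
    refine ⟨χ, ⟨hN0, hN1⟩, fun f => ⟨by rw [h4], ?_⟩⟩
    simp only [h5, map_mul, map_inv, toAdd_mul, toAdd_inv]
    omega

/-- The Goeritz elements `S₁^{∓1}` change the values `(v₁, v₂, v₃)` of a character `f : S₃ → ℤ`
killing `a₁` on `(b₁, b₂, a₃)` to `(v₁ ± v₂, v₂, v₃)`. [folklore] -/
private theorem moveS1 (u : ℤ) (hu : u = 1 ∨ u = -1) :
    ∃ χ : SurfaceGroup 3 ≃* SurfaceGroup 3,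
      ((s4Kernels 0).map χ.toMonoidHom = s4Kernels 0 ∧ (s4Kernels 1).map χ.toMonoidHom = s4Kernels 1) ∧
      ∀ f : SurfaceGroup 3 →* Multiplicative ℤ, f (SurfaceGroup.a 0) = 1 →
        toAdd (f (χ (SurfaceGroup.b 0))) =
            toAdd (f (SurfaceGroup.b 0)) + u * toAdd (f (SurfaceGroup.b 1)) ∧
        toAdd (f (χ (SurfaceGroup.b 1))) = toAdd (f (SurfaceGroup.b 1)) ∧
        toAdd (f (χ (SurfaceGroup.a 2))) = toAdd (f (SurfaceGroup.a 2)) := by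
  obtain ⟨χ, h1, h2, -, h4, h5, -, hN0, hN1⟩ := stub_goeritzS1
  rcases hu with rfl | rfl
  · -- `u = 1`: the inverse `S₁⁻¹`
    have k1 : χ.symm (SurfaceGroup.a 0) = SurfaceGroup.a 0 := by
      simpa using (congrArg χ.symm h1).symm
    have k4 : χ.symm (SurfaceGroup.b 1) = SurfaceGroup.b 1 := by
      simpa using (congrArg χ.symm h4).symm
    have k2 := congrArg χ.symm h2
    have k5 := congrArg χ.symm h5
    simp only [MulEquiv.symm_apply_apply, map_mul, map_inv, k1, k4] at k2 k5
    refine ⟨χ.symm,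
      ⟨(Subgroup.map_symm_eq_iff_map_eq _).2 hN0, (Subgroup.map_symm_eq_iff_map_eq _).2 hN1⟩,
      fun f hf => ⟨?_, by rw [k4], ?_⟩⟩
    · have e := congrArg (fun x => toAdd (f x)) k2
      simp only [map_mul, map_inv, toAdd_mul, toAdd_inv, hf, toAdd_one] at e
      omega
    · have e := congrArg (fun x => toAdd (f x)) k5
      simp only [map_mul, map_inv, toAdd_mul, toAdd_inv] at e
      omega
  · -- `u = -1`: `S₁` itself
    refine ⟨χ, ⟨hN0, hN1⟩, fun f hf => ⟨?_, by rw [h4], ?_⟩⟩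
    · simp only [h2, map_mul, map_inv, toAdd_mul, toAdd_inv, hf, toAdd_one]
      omega
    · simp only [h5, map_mul, map_inv, toAdd_mul, toAdd_inv]
      omega

/-! ### Book-keeping: moves preserve the hypotheses and transport the conclusion -/

/-- A character killing `a₁, a₂, b₃` kills `N₀ = ⟪a₁,a₂,b₃⟫`. [folklore] -/
private theorem s4Kernels_zero_le_ker (f : SurfaceGroup 3 →* Multiplicative ℤ)
    (h0 : f (SurfaceGroup.a 0) = 1) (h1 : f (SurfaceGroup.a 1) = 1) (h2 : f (SurfaceGroup.b 2) = 1) :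
    s4Kernels 0 ≤ f.ker := by
  refine Subgroup.normalClosure_le_normal ?_
  rintro x hx
  simp only [Set.mem_insert_iff, Set.mem_singleton_iff] at hx
  rcases hx with rfl | rfl | rfl <;> simpa [MonoidHom.mem_ker]

/-- Precomposing with an automorphism stabilising `N₀` and `N₁` preserves the hypotheses
"kills `a₁, a₂, b₃`, surjective, `N₁ ⊔ ker = ⊤`". [folklore] -/
private theorem hyp_comp (χ : SurfaceGroup 3 ≃* SurfaceGroup 3)
    (hχ : (s4Kernels 0).map χ.toMonoidHom = s4Kernels 0 ∧ (s4Kernels 1).map χ.toMonoidHom = s4Kernels 1)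
    (f : SurfaceGroup 3 →* Multiplicative ℤ)
    (hf : f (SurfaceGroup.a 0) = 1 ∧ f (SurfaceGroup.a 1) = 1 ∧ f (SurfaceGroup.b 2) = 1 ∧
      Function.Surjective f ∧ s4Kernels 1 ⊔ f.ker = ⊤) :
    (f.comp χ.toMonoidHom) (SurfaceGroup.a 0) = 1 ∧ (f.comp χ.toMonoidHom) (SurfaceGroup.a 1) = 1 ∧
      (f.comp χ.toMonoidHom) (SurfaceGroup.b 2) = 1 ∧
      Function.Surjective (f.comp χ.toMonoidHom) ∧ s4Kernels 1 ⊔ (f.comp χ.toMonoidHom).ker = ⊤ := by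
  obtain ⟨h0, h1, h2, hs, hN⟩ := hf
  have kill : ∀ x ∈ s4Kernels 0, (f.comp χ.toMonoidHom) x = 1 := fun x hx =>
    s4Kernels_zero_le_ker f h0 h1 h2 (hχ.1 ▸ Subgroup.mem_map_of_mem χ.toMonoidHom hx)
  have hsymm : (s4Kernels 1).map χ.symm.toMonoidHom = s4Kernels 1 :=
    (Subgroup.map_symm_eq_iff_map_eq _).2 hχ.2
  refine ⟨kill _ (of_mem_s4Kernels 0 (x := (0, false)) (by simp [s4Gens])),
    kill _ (of_mem_s4Kernels 0 (x := (1, false)) (by simp [s4Gens])),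
    kill _ (of_mem_s4Kernels 0 (x := (2, true)) (by simp [s4Gens])), hs.comp χ.surjective, ?_⟩
  rw [← MonoidHom.comap_ker, Subgroup.comap_equiv_eq_map_symm', ← hsymm, ← Subgroup.map_sup, hN]
  exact Subgroup.map_top_of_surjective _ χ.symm.surjective

/-- If `χ` normalises `f ∘ χ₀` (with `χ₀` stabilising `N₀, N₁`), then `χ₀ ∘ χ` normalises `f`.
[folklore] -/
private theorem concl_comp (χ₀ : SurfaceGroup 3 ≃* SurfaceGroup 3)
    (hχ₀ : (s4Kernels 0).map χ₀.toMonoidHom = s4Kernels 0 ∧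
      (s4Kernels 1).map χ₀.toMonoidHom = s4Kernels 1)
    (f : SurfaceGroup 3 →* Multiplicative ℤ)
    (h : ∃ χ : SurfaceGroup 3 ≃* SurfaceGroup 3,
      (s4Kernels 0).map χ.toMonoidHom = s4Kernels 0 ∧ (s4Kernels 1).map χ.toMonoidHom = s4Kernels 1 ∧
      (f.comp χ₀.toMonoidHom) (χ (SurfaceGroup.a 0)) = 1 ∧
      (f.comp χ₀.toMonoidHom) (χ (SurfaceGroup.a 1)) = 1 ∧
      (f.comp χ₀.toMonoidHom) (χ (SurfaceGroup.a 2)) = 1 ∧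
      (f.comp χ₀.toMonoidHom) (χ (SurfaceGroup.b 0)) = 1 ∧
      (f.comp χ₀.toMonoidHom) (χ (SurfaceGroup.b 2)) = 1 ∧
      ((f.comp χ₀.toMonoidHom) (χ (SurfaceGroup.b 1)) = Multiplicative.ofAdd 1 ∨
        (f.comp χ₀.toMonoidHom) (χ (SurfaceGroup.b 1)) = Multiplicative.ofAdd (-1))) :
    ∃ χ : SurfaceGroup 3 ≃* SurfaceGroup 3,
      (s4Kernels 0).map χ.toMonoidHom = s4Kernels 0 ∧ (s4Kernels 1).map χ.toMonoidHom = s4Kernels 1 ∧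
      f (χ (SurfaceGroup.a 0)) = 1 ∧ f (χ (SurfaceGroup.a 1)) = 1 ∧ f (χ (SurfaceGroup.a 2)) = 1 ∧
      f (χ (SurfaceGroup.b 0)) = 1 ∧ f (χ (SurfaceGroup.b 2)) = 1 ∧
      (f (χ (SurfaceGroup.b 1)) = Multiplicative.ofAdd 1 ∨
        f (χ (SurfaceGroup.b 1)) = Multiplicative.ofAdd (-1)) := by
  obtain ⟨χ, hN0, hN1, hv⟩ := h
  refine ⟨χ.trans χ₀, ?_, ?_, hv⟩
  · rw [show (χ.trans χ₀).toMonoidHom = χ₀.toMonoidHom.comp χ.toMonoidHom from rfl,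
      ← Subgroup.map_map, hN0, hχ₀.1]
  · rw [show (χ.trans χ₀).toMonoidHom = χ₀.toMonoidHom.comp χ.toMonoidHom from rfl,
      ← Subgroup.map_map, hN1, hχ₀.2]

/-- The hypotheses say `gcd (f b₂, f a₃) = 1`: `f(N₁) = ⟨f b₂, f a₃⟩` and `N₁ ⊔ ker f = ⊤`.
[folklore] -/
private theorem coprime (f : SurfaceGroup 3 →* Multiplicative ℤ)
    (hf : f (SurfaceGroup.a 0) = 1 ∧ f (SurfaceGroup.a 1) = 1 ∧ f (SurfaceGroup.b 2) = 1 ∧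
      Function.Surjective f ∧ s4Kernels 1 ⊔ f.ker = ⊤) :
    ∃ m n : ℤ, m * toAdd (f (SurfaceGroup.b 1)) + n * toAdd (f (SurfaceGroup.a 2)) = 1 := by
  obtain ⟨h0, -, -, hs, hN⟩ := hf
  have key : (⊤ : Subgroup (Multiplicative ℤ)) ≤
      Subgroup.closure {f (SurfaceGroup.b 1), f (SurfaceGroup.a 2)} := by
    rw [← Subgroup.map_top_of_surjective f hs, ← hN, Subgroup.map_le_iff_le_comap]
    refine sup_le (Subgroup.normalClosure_le_normal ?_) fun x hx => ?_
    · rintro x hx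
      simp only [Set.mem_insert_iff, Set.mem_singleton_iff] at hx
      rcases hx with rfl | rfl | rfl
      · simp [h0]
      · exact Subgroup.subset_closure (by simp)
      · exact Subgroup.subset_closure (by simp)
    · rw [MonoidHom.mem_ker] at hx
      simp [Subgroup.mem_comap, hx]
  obtain ⟨m, n, hmn⟩ :=
    Subgroup.mem_closure_pair.1 (key (Subgroup.mem_top (Multiplicative.ofAdd (1 : ℤ))))
  refine ⟨m, n, ?_⟩
  have e := congrArg toAdd hmn
  simpa [toAdd_mul, toAdd_zpow] using e

/-! ### The terminal case `(v₂, v₃) = (±1, 0)`: kill `v₁` with `S₁^{±1}` -/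

/-- Terminal case of the Euclidean algorithm: if `f a₃ = 0` and `f b₂ = ±1`, then `|f b₁|`
applications of `S₁^{±1}` bring `f` to `±` the standard face character. [folklore] -/
private theorem terminal : ∀ n : ℕ, ∀ f : SurfaceGroup 3 →* Multiplicative ℤ,
    (f (SurfaceGroup.a 0) = 1 ∧ f (SurfaceGroup.a 1) = 1 ∧ f (SurfaceGroup.b 2) = 1 ∧
      Function.Surjective f ∧ s4Kernels 1 ⊔ f.ker = ⊤) →
    (toAdd (f (SurfaceGroup.b 0))).natAbs ≤ n → toAdd (f (SurfaceGroup.a 2)) = 0 →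
    (toAdd (f (SurfaceGroup.b 1)) = 1 ∨ toAdd (f (SurfaceGroup.b 1)) = -1) →
    ∃ χ : SurfaceGroup 3 ≃* SurfaceGroup 3,
      (s4Kernels 0).map χ.toMonoidHom = s4Kernels 0 ∧ (s4Kernels 1).map χ.toMonoidHom = s4Kernels 1 ∧
      f (χ (SurfaceGroup.a 0)) = 1 ∧ f (χ (SurfaceGroup.a 1)) = 1 ∧ f (χ (SurfaceGroup.a 2)) = 1 ∧
      f (χ (SurfaceGroup.b 0)) = 1 ∧ f (χ (SurfaceGroup.b 2)) = 1 ∧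
      (f (χ (SurfaceGroup.b 1)) = Multiplicative.ofAdd 1 ∨
        f (χ (SurfaceGroup.b 1)) = Multiplicative.ofAdd (-1)) := by
  intro n
  induction n with
  | zero =>
    intro f hf hv h3 h2
    refine ⟨MulEquiv.refl _, by simp, by simp, hf.1, hf.2.1, toAdd_eq_zero.1 h3,
      (show f (SurfaceGroup.b 0) = 1 from toAdd_eq_zero.1 (by omega)), hf.2.2.1, ?_⟩
    rcases h2 with h2 | h2
    · exact Or.inl (toAdd.injective h2)
    · exact Or.inr (toAdd.injective h2)
  | succ n ih =>
    intro f hf hv h3 h2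
    by_cases hle : (toAdd (f (SurfaceGroup.b 0))).natAbs ≤ n
    · exact ih f hf hle h3 h2
    obtain ⟨u, hu, hn⟩ : ∃ u : ℤ, (u = 1 ∨ u = -1) ∧
        (toAdd (f (SurfaceGroup.b 0)) + u * toAdd (f (SurfaceGroup.b 1))).natAbs ≤ n := by
      rcases h2 with h2 | h2 <;> rcases le_or_gt 0 (toAdd (f (SurfaceGroup.b 0))) with hs | hs
      exacts [⟨-1, Or.inr rfl, by omega⟩, ⟨1, Or.inl rfl, by omega⟩, ⟨1, Or.inl rfl, by omega⟩,
        ⟨-1, Or.inr rfl, by omega⟩]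
    obtain ⟨χ₀, hχ₀, hval⟩ := moveS1 u hu
    obtain ⟨e1, e2, e3⟩ := hval f hf.1
    refine concl_comp χ₀ hχ₀ f (ih _ (hyp_comp χ₀ hχ₀ f hf) ?_ ?_ ?_)
    · show (toAdd (f (χ₀ (SurfaceGroup.b 0)))).natAbs ≤ n
      rwa [e1]
    · show toAdd (f (χ₀ (SurfaceGroup.a 2))) = 0
      rw [e3, h3]
    · show toAdd (f (χ₀ (SurfaceGroup.b 1))) = 1 ∨ toAdd (f (χ₀ (SurfaceGroup.b 1))) = -1
      rwa [e2]

/-- **STUB F2 · `stub_faceEuclid`** (def-free, genus 3; the Euclidean algorithm on the face):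
every surjective character `f : S₃ →* ℤ` killing `a₁, a₂, b₃` with `N₁ ⊔ ker f = ⊤` (i.e.
`gcd(f b₂, f a₃) = 1`) is carried by an automorphism `χ` stabilising `N₀` AND `N₁` to `±` the
standard face character (`b₂ ↦ ±1`, every other generator `↦ 0`). Route: strong induction on
`|f b₂| + |f a₃|` then induction on `|f b₁|`, using the Goeritz elements `σ₂₃` (`moveSigma`,
`(v₁,v₂,v₃) ↦ (v₁,v₃,v₂)`) and the landed `stub_goeritzS2` (`↦ (v₁,v₂,v₃−v₂)`; its
inverse `↦ (v₁,v₂,v₃+v₂)`), `stub_goeritzS1` (`↦ (v₁−v₂,v₂,v₃)`; inverse `↦ (v₁+v₂,v₂,v₃)`),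
where `vᵢ` are the values of the current character `f ∘ χ` on `b₁, b₂, a₃`; each move keeps
"kills `a₁,a₂,b₃`" (the elements stabilise `N₀ ≤ ker f`), surjectivity and `N₁ ⊔ ker = ⊤`.
[folklore] -/
theorem stub_faceEuclid :
    ∀ f : SurfaceGroup 3 →* Multiplicative ℤ,
      f (SurfaceGroup.a 0) = 1 → f (SurfaceGroup.a 1) = 1 → f (SurfaceGroup.b 2) = 1 →
      Function.Surjective f → s4Kernels 1 ⊔ f.ker = ⊤ →
      ∃ χ : SurfaceGroup 3 ≃* SurfaceGroup 3,
        (s4Kernels 0).map χ.toMonoidHom = s4Kernels 0 ∧ (s4Kernels 1).map χ.toMonoidHom = s4Kernels 1 ∧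
        f (χ (SurfaceGroup.a 0)) = 1 ∧ f (χ (SurfaceGroup.a 1)) = 1 ∧ f (χ (SurfaceGroup.a 2)) = 1 ∧
        f (χ (SurfaceGroup.b 0)) = 1 ∧ f (χ (SurfaceGroup.b 2)) = 1 ∧
        (f (χ (SurfaceGroup.b 1)) = Multiplicative.ofAdd 1 ∨
          f (χ (SurfaceGroup.b 1)) = Multiplicative.ofAdd (-1)) := by
  -- strong induction on `|f b₂| + |f a₃|`
  suffices key : ∀ n : ℕ, ∀ f : SurfaceGroup 3 →* Multiplicative ℤ,
      (f (SurfaceGroup.a 0) = 1 ∧ f (SurfaceGroup.a 1) = 1 ∧ f (SurfaceGroup.b 2) = 1 ∧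
        Function.Surjective f ∧ s4Kernels 1 ⊔ f.ker = ⊤) →
      (toAdd (f (SurfaceGroup.b 1))).natAbs + (toAdd (f (SurfaceGroup.a 2))).natAbs ≤ n →
      ∃ χ : SurfaceGroup 3 ≃* SurfaceGroup 3,
        (s4Kernels 0).map χ.toMonoidHom = s4Kernels 0 ∧ (s4Kernels 1).map χ.toMonoidHom = s4Kernels 1 ∧
        f (χ (SurfaceGroup.a 0)) = 1 ∧ f (χ (SurfaceGroup.a 1)) = 1 ∧ f (χ (SurfaceGroup.a 2)) = 1 ∧
        f (χ (SurfaceGroup.b 0)) = 1 ∧ f (χ (SurfaceGroup.b 2)) = 1 ∧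
        (f (χ (SurfaceGroup.b 1)) = Multiplicative.ofAdd 1 ∨
          f (χ (SurfaceGroup.b 1)) = Multiplicative.ofAdd (-1)) by
    intro f h0 h1 h2 hs hN
    exact key _ f ⟨h0, h1, h2, hs, hN⟩ le_rfl
  intro n
  induction n using Nat.strong_induction_on with
  | _ n ih =>
  -- the half-case `|v₂| ≤ |v₃|`
  have half : ∀ f : SurfaceGroup 3 →* Multiplicative ℤ,
      (f (SurfaceGroup.a 0) = 1 ∧ f (SurfaceGroup.a 1) = 1 ∧ f (SurfaceGroup.b 2) = 1 ∧
        Function.Surjective f ∧ s4Kernels 1 ⊔ f.ker = ⊤) →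
      (toAdd (f (SurfaceGroup.b 1))).natAbs + (toAdd (f (SurfaceGroup.a 2))).natAbs ≤ n →
      (toAdd (f (SurfaceGroup.b 1))).natAbs ≤ (toAdd (f (SurfaceGroup.a 2))).natAbs →
      ∃ χ : SurfaceGroup 3 ≃* SurfaceGroup 3,
        (s4Kernels 0).map χ.toMonoidHom = s4Kernels 0 ∧ (s4Kernels 1).map χ.toMonoidHom = s4Kernels 1 ∧
        f (χ (SurfaceGroup.a 0)) = 1 ∧ f (χ (SurfaceGroup.a 1)) = 1 ∧ f (χ (SurfaceGroup.a 2)) = 1 ∧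
        f (χ (SurfaceGroup.b 0)) = 1 ∧ f (χ (SurfaceGroup.b 2)) = 1 ∧
        (f (χ (SurfaceGroup.b 1)) = Multiplicative.ofAdd 1 ∨
          f (χ (SurfaceGroup.b 1)) = Multiplicative.ofAdd (-1)) := by
    intro f hf hn hle
    obtain ⟨p, q, hpq⟩ := coprime f hf
    by_cases h2 : toAdd (f (SurfaceGroup.b 1)) = 0
    · -- `v₂ = 0`, so `v₃ = ±1`: swap with `σ₂₃`, then the terminal case
      have h3 : toAdd (f (SurfaceGroup.a 2)) = 1 ∨ toAdd (f (SurfaceGroup.a 2)) = -1 := by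
        rw [h2, mul_zero, zero_add, mul_comm] at hpq
        exact Int.eq_one_or_neg_one_of_mul_eq_one hpq
      obtain ⟨χ₀, hχ₀, hval⟩ := moveSigma
      obtain ⟨e2, e3⟩ := hval f
      refine concl_comp χ₀ hχ₀ f (terminal _ _ (hyp_comp χ₀ hχ₀ f hf) le_rfl ?_ ?_)
      · show toAdd (f (χ₀ (SurfaceGroup.a 2))) = 0
        rw [e3, h2]
      · show toAdd (f (χ₀ (SurfaceGroup.b 1))) = 1 ∨ toAdd (f (χ₀ (SurfaceGroup.b 1))) = -1
        rwa [e2]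
    · by_cases h3 : toAdd (f (SurfaceGroup.a 2)) = 0
      · exact absurd (by omega) h2
      -- both nonzero: one step of Euclid with `S₂^{±1}`
      obtain ⟨u, hu, hlt⟩ : ∃ u : ℤ, (u = 1 ∨ u = -1) ∧
          (toAdd (f (SurfaceGroup.a 2)) + u * toAdd (f (SurfaceGroup.b 1))).natAbs <
            (toAdd (f (SurfaceGroup.a 2))).natAbs := by
        rcases le_or_gt 0 (toAdd (f (SurfaceGroup.b 1))) with s2 | s2 <;>
          rcases le_or_gt 0 (toAdd (f (SurfaceGroup.a 2))) with s3 | s3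
        exacts [⟨-1, Or.inr rfl, by omega⟩, ⟨1, Or.inl rfl, by omega⟩, ⟨1, Or.inl rfl, by omega⟩,
          ⟨-1, Or.inr rfl, by omega⟩]
      obtain ⟨χ₀, hχ₀, hval⟩ := moveS2 u hu
      obtain ⟨e2, e3⟩ := hval f
      refine concl_comp χ₀ hχ₀ f (ih _ ?_ _ (hyp_comp χ₀ hχ₀ f hf) le_rfl)
      show (toAdd (f (χ₀ (SurfaceGroup.b 1)))).natAbs + (toAdd (f (χ₀ (SurfaceGroup.a 2)))).natAbs < n
      rw [e2, e3]
      omega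
  intro f hf hn
  rcases le_or_gt (toAdd (f (SurfaceGroup.b 1))).natAbs (toAdd (f (SurfaceGroup.a 2))).natAbs with
    hle | hlt
  · exact half f hf hn hle
  · -- `|v₂| > |v₃|`: swap with `σ₂₃` first
    obtain ⟨χ₀, hχ₀, hval⟩ := moveSigma
    obtain ⟨e2, e3⟩ := hval f
    refine concl_comp χ₀ hχ₀ f (half _ (hyp_comp χ₀ hχ₀ f hf) ?_ ?_)
    · show (toAdd (f (χ₀ (SurfaceGroup.b 1)))).natAbs + (toAdd (f (χ₀ (SurfaceGroup.a 2)))).natAbs ≤ n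
      rw [e2, e3]
      omega
    · show (toAdd (f (χ₀ (SurfaceGroup.b 1)))).natAbs ≤ (toAdd (f (χ₀ (SurfaceGroup.a 2)))).natAbs
      rw [e2, e3]
      omega

end Summit.SmoothPoincare4.SmoothPoincare4.Theorems.ShadowsStandard.PowerTwistAbsorption
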